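import Summits.AtomisticToContinuum.HydrodynamicLimit.Theses.AnnealedZeroHorizon
import Summits.AtomisticToContinuum.HydrodynamicLimit.Theorems.AnnealedZeroHorizonDefs
import Summits.AtomisticToContinuum.HydrodynamicLimit.Theorems.AnnealedZeroHorizonAnnealedWeakStrongTimeZeroMean
import Summits.AtomisticToContinuum.HydrodynamicLimit.Theorems.AnnealedZeroHorizonAnnealedWeakStrongHsRelEtaCoercive
import Summits.AtomisticToContinuum.HydrodynamicLimit.Theorems.AnnealedZeroHorizonAnnealedWeakStrongFieldsCloseTendsto
import Summits.AtomisticToContinuum.HydrodynamicLimit.Theorems.AnnealedZeroHorizonAnnealedWeakStrongSmallRelEntropyFieldsClose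
import Summits.AtomisticToContinuum.HydrodynamicLimit.Theorems.AnnealedZeroHorizonAnnealedWeakStrongEnergyFluxObstruction

/-!
# Skeleton of the crux `AnnealedWeakStrong` (stmt-AtomisticToContinuum-9258), line `registered`

Lead `prover-line-stmt-AtomisticToContinuum-9258-c1` (cycle 1, 2026-08-17): the planner's birth skeleton
`Lines/birth.lean`, namespace moved to `…Theorems.AWS`, §0 objects = the objects module
`Theorems/AnnealedZeroHorizonDefs.lean` (p143553, landed) + bookkeeping stub `stub_objects` (S0, proved there);
stubs S1–S3 and the composition unchanged.
Wave-1 integration (2026-08-17): S1 `stub_timeZeroMeanConvergence` (p145914), S3a `stub_hsRelEtaCoercive` (p146666) and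
S3c `stub_fieldsCloseTendsto` (p145913) LANDED and are imported (their `Sig` defs live in those files); the S2→S3
hand-over currency is now the junk-free `RelEntropyLIntSmallAt` (objects module, 3rd append; S3b worker report + lead
dossier R3): S2 concludes it, S3b consumes it. Open stubs: S2 (lead; dead-heart dossier `LeadC1-S2-dossier.md`), S3b
(proved by the worker in the new currency, LANDED `…SmallRelEntropyFieldsClose.lean`).

Route `route-AtomisticToContinuum-AnnealedZeroHorizon`, crux decl
`Summit.AtomisticToContinuum.HydrodynamicLimit.Theses.AnnealedZeroHorizon.AnnealedWeakStrong`
(`MeanFluxClosure → MeanSecondLaw → <the packing-guarded conjunct HydrodynamicLimit, verbatim>`).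
Skeleton registrar `planner-skel-stmt-AtomisticToContinuum-9258-0`, 2026-08-17 (BC3 birth certificate of the
crux; re-audit bin REPAIRABLE). Nothing here restates the crux or the Statement: the three stubs are the three
moves of the Fjordholm–Lye–Mishra–Weber weak–strong argument for dissipative statistical solutions with a
Dirac initial law (FjordholmEtAl2020, Lemma 28 with `M = 1`), transplanted to the hard-sphere gas at fixed
reduced density and run IN EXPECTATION over the local Gibbs initial law (annealed), with the Dafermos /
Březina–Feireisl relative entropy of the hard-sphere equation of state as the Lyapunov quantity:

* the OBJECT is the mean coarse-grained relative entropy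
  `H^k_N(t) = E_{localGibbs} ∫ η_σ(U^k_N(t,x) | Ū(t,x)) dx`, where `U^k_N(t,x)` are the `k`-mollified empirical
  conserved fields `(ρ^k, m^k, E^k)` of the time-`t` configuration (same mollifiers `k` as the route's
  `MeanFluxClosure` / `MeanSecondLaw`: continuous probability kernels supported in the `ℓ`-ball),
  `Ū = (ρ, ρu, E(ρ,u,θ))` is the classical hard-sphere Euler solution, `η_σ(U) = −ρ(3/2 log θ(U) − log ρ −
  f_ex(ρσ³))` is the mathematical entropy in conserved variables (verbatim the integrand of `MeanSecondLaw` and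
  of the landed `HsEntropyConvex`), and `η_σ(U | V) = η_σ(U) − η_σ(V) − Dη_σ(V)(U − V)` its Bregman divergence
  (`fderiv`); "small" always means the route's double limit: `∀ ε > 0 ∃ ℓ > 0 ∀ k ⊂ B_ℓ, eventually in N, ≤ ε`.
* `stub_timeZeroMeanConvergence` (S1, statics + uniform integrability, size M, provable now): under the local
  Gibbs law, convergence IN PROBABILITY of the tested fields at `t = 0` (the crux's hypothesis) upgrades to
  convergence IN MEAN, in `L¹(P ⊗ dx)`, of the mollified fields to `Ū(0, ·)` (Maxwellian velocity moments of
  `localGibbsLaw` give uniform integrability; `Ū(0,·)` is continuous). Cf. the landed fine-scale statics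
  `LocalGibbsFineScale` (route BoxDissipativeWeakStrong, `Theorems.localGibbsFineScale_proof`).
* `stub_meanRelEntropyGronwall` (S2, THE HEART, size L): `MeanFluxClosure → MeanSecondLaw →` for classical
  solutions that stay dilute (`ρσ³ < η`), mean convergence at `t = 0` propagates to `H^k_N(t) → 0` at every
  `t < T`: `H(t) = E∫η(U^k(t)) − ∫η(Ū(t)) − L(t)` with `L(t) = E∫Dη(Ū(t))·(U^k(t) − Ū(t))`; the first difference
  is `≤ ε` by `MeanSecondLaw` (applied with `(ρ₁,u₁,θ₁) = Ū(0)`) and isentropy of the classical solution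
  (`HsEosLowDensity`, landed); `L(0) → 0` by S1; `L(t) − L(0)` is computed from the mean conservation laws
  (`MeanFluxClosure` tested with the frozen entropy variables `Dη(Ū(s))` on a time grid, mass from the landed
  `MassContinuity`) and the Euler equations of `Ū`, leaving `−E∫∇ₓDη(Ū) : [F(U^k) − F(Ū) − DF(Ū)(U^k − Ū)]`,
  whose integrand is `≲ η_σ(U^k | Ū)` (relative flux ≲ relative entropy, BrezinaFeireisl2018 §3 for the complete
  Euler system; this is where the state-space control named in the crux's why-line lives); Grönwall in `t`.
  Uses every `_false_without_`-type obstruction one expects: all three balance laws (through `MeanFluxClosure` +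
  `MassContinuity`), the second law (`MeanSecondLaw`), the tie to the data (S1's conclusion), `0 < σ` and the
  packing guard (strict convexity / analyticity of the EOS below `η`, `HsEntropyConvex` + `HsEosLowDensity`).
* `stub_relEntropyCoercive` (S3, convex analysis + measure theory, size M–L): below a packing threshold,
  `H^k_N(t) → 0` (double limit) forces `TendstoHydroFieldsAt` at time `t`: Bregman coercivity of the strictly
  convex `η_σ` near the compact range of `Ū(t,·)` and linear growth away from it (Markov), then the mollifier is
  moved onto the continuous test function `χ` (`|k̃ * χ − χ| ≤ ω_χ(ℓ)`), the velocity moments being controlled by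
  the energy field itself.
* Composition `AnnealedWeakStrong_of : S1 → S2 → S3 → AnnealedWeakStrong` (sorry-free; real content: the
  packing threshold `min η₂ η₃`, the density threshold `min σ₁ (min σ₂ σ₃)`, `0 < T` from `t ∈ [0,T)`, and the
  chaining S3 ∘ S2 ∘ S1 at each `t`), and `AnnealedWeakStrong_skeleton` = the crux modulo the three sorries.

Disproof used: none exists yet for this crux (`ledger crux ls stmt-AtomisticToContinuum-9258`: no workfiles at
registration). Negatives index: no refuted statement of the summit is an instance of S1–S3 (they are keyed on
the UNclamped `hsExcessFreeEnergy` exactly as the route's own MeanSecondLaw; no exponential tail budget, no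
clamp, no kinetic window).
-/

noncomputable section

open MeasureTheory Filter Set
open scoped ENNReal Topology

namespace Summit.AtomisticToContinuum.HydrodynamicLimit.Theorems.AWS

open Literature.MathematicalPhysics.KineticTheory Literature.Analysis.FluidPDE
open Summit.AtomisticToContinuum.HydrodynamicLimit.Theses

/-! ## §0 Objects of the line

The objects (`State`, `consState`, `mollState`, `IsKernel`, `hsEta`, `hsRelEta`, `stateDist`, `relEntropyObs`,
`fieldDistObs`, `RelEntropySmallAt`, `MeanFieldsCloseAt`) live in the landed objects module
`Theorems/AnnealedZeroHorizonDefs.lean` (p143553, namespace `…Theorems.AWS`, imported above). -/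

/-! ## §1 Stub signatures

Each stub's statement is the `Prop` `Sig.stub_<name>`; the registered obligation is
`theorem stub_<name> : Sig.stub_<name> := by sorry` (§2); the composition `AnnealedWeakStrong_of` takes the three
signatures as hypotheses BY NAME (skeleton audit: hypothesis heads = stub names; obligation tags are gate-stamped,
not written here). -/

/-- **S2 — the mean relative-entropy Grönwall (THE HEART; size L).** Under the route's annealed inputs
`MeanFluxClosure` and `MeanSecondLaw` there is a packing threshold `η > 0` such that for continuous positive
profiles and `σ < σ₀(profiles)`, for every classical hard-sphere Euler solution on `[0,T)` with `ρσ³ < η`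
throughout and every flow family: if at `t = 0` the local-Gibbs fields converge in probability (to unlock
`MeanSecondLaw` with `(ρ₁,u₁,θ₁) = Ū(0)`) and the mollified fields converge in mean (S1's conclusion, which kills
the linear term `L(0)`), then at every `t ∈ [0,T)` the mean relative entropy `E∫η_σ(U^k_N(t) | Ū(t)) dx` vanishes in
the double limit — in the junk-free currency `RelEntropyLIntSmallAt` (iterated lower integral of `ofReal η_σ(·|·)`) since the
wave-1 reshape. FjordholmEtAl2020 Lemma 28 (`M = 1`) in expectation: `MeanSecondLaw` + isentropy of the
classical flow bound `E∫η(U^k(t)) − ∫η(Ū(t))`; the linear functional `L(t)` is evolved by `MeanFluxClosure`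
(time grid, frozen entropy variables `Dη(Ū(s))`) + `MassContinuity` (landed) + the Euler equations of `Ū`; the
flux remainder is `≲ η_σ(U^k | Ū)` (BrezinaFeireisl2018 relative-energy technique for the complete Euler system,
strict convexity from the landed `HsEntropyConvex`, EOS analyticity from the landed `HsEosLowDensity`); Grönwall.
Why it might fail = the crux's own why-line: relative flux ≲ relative entropy is needed on ALL states the
mollified particle fields visit (cold / dense windows), not only near `Ū`. STATUS (lead dossier
`Cruxes/AnnealedWeakStrong/LeadC1-S2-dossier.md`): not derivable from the line's inputs — (R1) the energy-flux remainder is cubic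
in the velocity against `∇(1/θ̄)`, (R2) the pressure remainder needs the EOS above the analytic band; both need positive-time
tightness that `MeanFluxClosure`/`MeanSecondLaw` do not supply. -/
def Sig.stub_meanRelEntropyGronwall : Prop :=
  AnnealedZeroHorizon.MeanFluxClosure → AnnealedZeroHorizon.MeanSecondLaw →
    ∃ η : ℝ, 0 < η ∧
      ∀ (a₀ θ₀ : T3 → ℝ) (u₀ : T3 → V3), Continuous a₀ → Continuous θ₀ → Continuous u₀ →
        (∀ x, 0 < a₀ x) → (∀ x, 0 < θ₀ x) →
        ∃ σ₀ : ℝ, 0 < σ₀ ∧ ∀ σ : ℝ, 0 < σ → σ < σ₀ →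
          ∀ (T : ℝ) (ρ θ : ℝ → T3 → ℝ) (u : ℝ → T3 → V3), IsHardSphereEulerSolution σ T ρ u θ →
            (∀ t ∈ Ico 0 T, ∀ x, ρ t x * σ ^ 3 < η) →
            ∀ Φ : (N : ℕ) → HardSphereFlow (Literature.Analysis.FluidPDE.Torus.geometry (Fin 3)) (hsDiameter σ N) (N + 1),
              TendstoHydroFieldsAt (fun N => localGibbsLaw σ a₀ u₀ θ₀ N (Φ N)) Φ ρ u θ 0 →
                MeanFieldsCloseAt σ a₀ u₀ θ₀ Φ ρ u θ 0 →
                  ∀ t ∈ Ico 0 T, RelEntropyLIntSmallAt σ a₀ u₀ θ₀ Φ ρ u θ t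

/-- **S3 (derived since the cycle-1 reshape; no longer a stub) — relative entropy is coercive.** There is a
packing threshold `η > 0` such that for continuous positive profiles and `σ < σ₀(profiles)`, for every classical
solution with `ρσ³ < η` on `[0,T)`, every flow family and every `t ∈ [0,T)`: if the mean relative entropy at
time `t` vanishes in the double limit, then the empirical fields at time `t` converge in probability to
`(ρ, ρu, E)(t)`. Proved below (`relEntropyCoercive_of`) from S3a (pointwise coercivity of `η_σ(·|·)` on the
realizable cone, junk included), S3b (mean relative entropy small ⇒ fields close in mean along good kernels)
and S3c (fields close in mean along some kernels of vanishing radius ⇒ `TendstoHydroFieldsAt`). -/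
def Sig.stub_relEntropyCoercive : Prop :=
  ∃ η : ℝ, 0 < η ∧
    ∀ (a₀ θ₀ : T3 → ℝ) (u₀ : T3 → V3), Continuous a₀ → Continuous θ₀ → Continuous u₀ →
      (∀ x, 0 < a₀ x) → (∀ x, 0 < θ₀ x) →
      ∃ σ₀ : ℝ, 0 < σ₀ ∧ ∀ σ : ℝ, 0 < σ → σ < σ₀ →
        ∀ (T : ℝ) (ρ θ : ℝ → T3 → ℝ) (u : ℝ → T3 → V3), IsHardSphereEulerSolution σ T ρ u θ →
          (∀ t ∈ Ico 0 T, ∀ x, ρ t x * σ ^ 3 < η) →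
          ∀ Φ : (N : ℕ) → HardSphereFlow (Literature.Analysis.FluidPDE.Torus.geometry (Fin 3)) (hsDiameter σ N) (N + 1),
            ∀ t ∈ Ico 0 T, RelEntropyLIntSmallAt σ a₀ u₀ θ₀ Φ ρ u θ t →
              TendstoHydroFieldsAt (fun N => localGibbsLaw σ a₀ u₀ θ₀ N (Φ N)) Φ ρ u θ t

/-! ## §2 Stubs (registered; `sorry` only inside them) — hardest: `stub_meanRelEntropyGronwall`

Cycle-1 reshape (lead): S3 `stub_relEntropyCoercive` ↦ S3a `stub_hsRelEtaCoercive` + S3b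
`stub_smallRelEntropyFieldsClose` + S3c `stub_fieldsCloseTendsto` (glue `relEntropyCoercive_of`, §3). After wave 1 the
landed S1, S3a, S3c and (since the wave-1 integration) S3b are imported; the ONLY open stub is S2 (lead), whose pointwise
obstruction `stub_energyFluxObstruction` (R1) is imported from the landed evidence file `…EnergyFluxObstruction.lean`. -/

/-- **S2 (L; the heart).** The mean relative-entropy Grönwall under `MeanFluxClosure` + `MeanSecondLaw`. -/
theorem stub_meanRelEntropyGronwall : Sig.stub_meanRelEntropyGronwall := by
  sorry

/-! ## §3 Composition (sorry-free) -/

/-- **Glue of the reshaped S3**: coercivity of the mean relative entropy from S3a, S3b, S3c. Real content: the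
packing threshold of S3b (fed with S3a), its density threshold, and continuity of the time-`t` slices of the
classical solution (`IsSmoothSpaceTimeOn.isSmooth_slice`) for S3c. -/
theorem relEntropyCoercive_of (h₃a : Sig.stub_hsRelEtaCoercive) (h₃b : Sig.stub_smallRelEntropyFieldsClose)
    (h₃c : Sig.stub_fieldsCloseTendsto) : Sig.stub_relEntropyCoercive := by
  obtain ⟨η, hη, H⟩ := h₃b h₃a
  refine ⟨η, hη, fun a₀ θ₀ u₀ ha hθ hu hap hθp => ?_⟩
  obtain ⟨σ₀, hσ₀, G⟩ := H a₀ θ₀ u₀ ha hθ hu hap hθp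
  refine ⟨σ₀, hσ₀, fun σ hσ hσlt T ρ θ u hsol hpack Φ t ht hrel => ?_⟩
  have hρc : Continuous (ρ t) := (hsol.smooth_density.isSmooth_slice ht).continuous
  have huc : Continuous (u t) := (hsol.smooth_velocity.isSmooth_slice ht).continuous
  have hθc : Continuous (θ t) := (hsol.smooth_temperature.isSmooth_slice ht).continuous
  exact h₃c σ a₀ θ₀ u₀ Φ ρ θ u t hρc huc hθc (G σ hσ hσlt T ρ θ u hsol hpack Φ t ht hrel)

/-- **General composition (documentation of the line)**: `AnnealedWeakStrong` from the five stub SIGNATURES S1, S2, S3a, S3b,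
S3c taken as hypotheses (the form registered before wave 1; kept for re-lining with other inputs); stated with the conclusion
unfolded to `MeanFluxClosure → MeanSecondLaw → HydrodynamicLimit` (definitionally the crux) so that the skeleton audit reads
`AnnealedWeakStrong_of` below as THE composition. Real content: the common packing threshold `min η₂ η₃`, the common density threshold `min σ₁ (min σ₂ σ₃)`, `0 < T`
extracted from `t ∈ [0,T)`, and the chaining coercivity ∘ Grönwall ∘ statics at each time `t`. -/
theorem AnnealedWeakStrong_of_stubs (h₁ : Sig.stub_timeZeroMeanConvergence)
    (h₂ : Sig.stub_meanRelEntropyGronwall) (h₃a : Sig.stub_hsRelEtaCoercive)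
    (h₃b : Sig.stub_smallRelEntropyFieldsClose) (h₃c : Sig.stub_fieldsCloseTendsto) :
    AnnealedZeroHorizon.MeanFluxClosure → AnnealedZeroHorizon.MeanSecondLaw → _root_.HydrodynamicLimit := by
  have h₃ : Sig.stub_relEntropyCoercive := relEntropyCoercive_of h₃a h₃b h₃c
  intro hMFC hMSL
  obtain ⟨η₂, hη₂, H₂⟩ := h₂ hMFC hMSL
  obtain ⟨η₃, hη₃, H₃⟩ := h₃
  refine ⟨min η₂ η₃, lt_min hη₂ hη₃, ?_⟩
  intro a₀ θ₀ u₀ ha hθ hu hap hθp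
  obtain ⟨σ₁, hσ₁, G₁⟩ := h₁ a₀ θ₀ u₀ ha hθ hu hap hθp
  obtain ⟨σ₂, hσ₂, G₂⟩ := H₂ a₀ θ₀ u₀ ha hθ hu hap hθp
  obtain ⟨σ₃, hσ₃, G₃⟩ := H₃ a₀ θ₀ u₀ ha hθ hu hap hθp
  refine ⟨min σ₁ (min σ₂ σ₃), lt_min hσ₁ (lt_min hσ₂ hσ₃), ?_⟩
  intro σ hσ hσlt T ρ θ u hsol hpack Φ h0 t ht
  have hσ₁' : σ < σ₁ := lt_of_lt_of_le hσlt (min_le_left _ _)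
  have hσ₂' : σ < σ₂ := lt_of_lt_of_le hσlt ((min_le_right _ _).trans (min_le_left _ _))
  have hσ₃' : σ < σ₃ := lt_of_lt_of_le hσlt ((min_le_right _ _).trans (min_le_right _ _))
  have hT : 0 < T := lt_of_le_of_lt ht.1 ht.2
  have hpack₂ : ∀ s ∈ Ico 0 T, ∀ x, ρ s x * σ ^ 3 < η₂ :=
    fun s hs x => lt_of_lt_of_le (hpack s hs x) (min_le_left _ _)
  have hpack₃ : ∀ s ∈ Ico 0 T, ∀ x, ρ s x * σ ^ 3 < η₃ :=
    fun s hs x => lt_of_lt_of_le (hpack s hs x) (min_le_right _ _)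
  have hmean : MeanFieldsCloseAt σ a₀ u₀ θ₀ Φ ρ u θ 0 := G₁ σ hσ hσ₁' T ρ θ u hsol hT Φ h0
  have hrel : RelEntropyLIntSmallAt σ a₀ u₀ θ₀ Φ ρ u θ t :=
    G₂ σ hσ hσ₂' T ρ θ u hsol hpack₂ Φ h0 hmean t ht
  exact G₃ σ hσ hσ₃' T ρ θ u hsol hpack₃ Φ t ht hrel

/-- **The line closes the crux modulo its one open stub**: `AnnealedWeakStrong` BY NAME from S2
(`stub_meanRelEntropyGronwall`, open) and the LANDED stubs S1 `stub_timeZeroMeanConvergence` (p145914), S3a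
`stub_hsRelEtaCoercive` (p146666), S3b `stub_smallRelEntropyFieldsClose` (p146993), S3c `stub_fieldsCloseTendsto` (p145913),
discharged inside the proof. -/
theorem AnnealedWeakStrong_of (h₂ : Sig.stub_meanRelEntropyGronwall) : AnnealedZeroHorizon.AnnealedWeakStrong :=
  AnnealedWeakStrong_of_stubs stub_timeZeroMeanConvergence h₂ stub_hsRelEtaCoercive stub_smallRelEntropyFieldsClose
    stub_fieldsCloseTendsto

/-- The skeleton instantiated: the crux modulo the one open stub S2 (S1, S3a, S3b, S3c imported, landed). -/
theorem AnnealedWeakStrong_skeleton : AnnealedZeroHorizon.AnnealedWeakStrong :=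
  AnnealedWeakStrong_of stub_meanRelEntropyGronwall

end Summit.AtomisticToContinuum.HydrodynamicLimit.Theorems.AWS

end
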